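import Literature.NumberTheory.LFunctions.LiCriterionDirichlet
import Literature.NumberTheory.LFunctions.DirichletArgSBound
import HarnessLib

/-!
# Li's coefficient `λ_χ(n)` exists as printed for every primitive character
# (Li 2004, Theorem 4 — the existence half), RH-FREE

Topic `Literature/NumberTheory/LFunctions`, sub-namespace `LiDirichlet` (continuing
`LiCriterionDirichlet.lean`).  Everything in this file is PROVED (theorems only; no named facts).

X.-J. Li, *Explicit formulas for Dirichlet and Hecke `L`-functions*, Illinois J. Math. **48** (2004)
491–503, p. 494: "For `n = 1, 2, …` let `λ_χ(n) = Σ_ρ [1 − (1 − 1/ρ)ⁿ]`, where the sum on `ρ` runs over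
all zeros of `ξ(s, χ)` in the order given by `|Im ρ| < T` for `T → ∞`."  Li's Theorem 4 evaluates this
symmetric limit (an explicit arithmetic formula carrying `χ̄(k)`); in particular the limit EXISTS.  The
tree's `LiCriterionDirichlet.lean` types `λ_χ(n)` as printed (`LiDirichlet.liCoeffChar χ n`, the
`limUnder` of the symmetric partial sums over the boxes `lfunctionZeroBox χ T`) and records in its
docstring that the EXISTENCE of the limit «is Li's Theorem 4 …, not proved here»; for a REAL
character it proves existence (`tendsto_liPartialSum_of_real`).  This file proves existence for EVERY
primitive character `χ` modulo `q > 1`, complex characters included: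

* `LiDirichlet.tendsto_liPartialSum` — the partial sums `Σ_{|Im ρ| ≤ T} m_χ(ρ)[1 − (1 − 1/ρ)ⁿ]`
  converge as `T → ∞` (to `liCoeffChar χ n`);
* `LiDirichlet.re_liCoeffChar` — `Re λ_χ(n) = liCoeffCharRe χ n`, the absolutely convergent real sum
  on which the tree's criterion is stated;
* `LiDirichlet.riemannHypothesis_iff_re_liCoeffChar_nonneg` — **Li's criterion literally as printed
  for every primitive character**: `GRH(χ) ↔ Re λ_χ(n) ≥ 0` for all `n ≥ 1`, with Li's own `λ_χ(n)`
  (the tree had the as-printed form for REAL characters only, `…_of_real`, and «modulo the real part»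
  in general, `riemannHypothesis_iff_tendsto_re_nonneg`);
* `LiDirichlet.conj_liPartialSum`, `LiDirichlet.liCoeffChar_inv` — `λ_{χ̄}(n) = conj λ_χ(n)` (the zero
  multiset of `L(s, χ̄)` is the conjugate of that of `L(s, χ)`, MV §10.1).

## The proof (why the limit exists although the series does not converge absolutely)

`1 − (1 − 1/ρ)ⁿ = n/ρ + O(2ⁿ/|ρ|²)`, `Σ_ρ m(ρ)/|ρ|² < ∞`, and `Re(1/ρ) = β/|ρ|²` is summable as well.
The only conditionally convergent piece is `Im(1/ρ) = −γ/|ρ|²`, of size `∓1/|γ|` according to the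
sign of `γ`: for a complex character the zeros are NOT symmetric under `γ ↦ −γ` (those with `γ < 0`
are the reflected zeros of `χ̄`), and the symmetric truncation converges because the SIGNED count of
zeros between two heights is `O(log qT)`:  by Montgomery–Vaughan's Theorem 14.5 in the tree's
two-height form (`DirichletTheta.pi_mul_finsum_zeroOrder_eq`) and the oddness of the `Γ`-phase
(`gammaArgPhase_neg`), the `Γ`- and `log q`-terms cancel between `(a, b)` and `(−b, −a)`, leaving
`#{a < γ < b} − #{−b < γ < −a} = S(b, χ) − S(a, χ) − S(−a, χ) + S(−b, χ)`
(`finsum_zeroOrder_sub_finsum_zeroOrder_neg_eq`), each `|S| ≤ 5/2 + log(2q(|t| + 4)ζ(5/4))/log(7/6)`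
(`abs_dirichletArgS_le`, MV Lemma 12.8).  The rest is bookkeeping: admissible heights
`t_k ∈ [k, k + 1]` that are ordinates of no zero (`exists_goodHeight`, MV Lemma 12.7), unit-window
counts `≪ log q(k + 2)` (`exists_sum_window_le`, MV Thm 10.17), Abel summation of `Σ_k d_k/k` for
the signed block counts `d_k`, the Cauchy criterion in `ℂ` along `t_k`, and the passage from `t_k`
to a real `T` by the window bound.

## What this is NOT

An RH-free / GRH-free existence theorem about a conditionally convergent sum over zeros.  It does
not evaluate `λ_χ(n)` (Li's arithmetic formula for `Im λ_χ(n)` is not claimed here), it says nothing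
about the sign of `Re λ_χ(n)`, and nothing here bears on the truth of RH or GRH; the criterion remains
an RH-EQUIVALENT `∀ n` statement.

## References

* X.-J. Li, Illinois J. Math. 48 (2004) 491–503: definition of `λ_χ(n)` (p. 494), Theorem 4, and the
  criterion on p. 494. [Li2004]
* H. L. Montgomery, R. C. Vaughan, *Multiplicative Number Theory I*, CUP 2007: Theorem 14.5 and the
  remark after it (p. 454), Lemma 12.8, Corollary 14.7, Theorem 10.17, Lemma 12.7, §10.1.
  [MontgomeryVaughan2007]
* E. Bombieri, J. C. Lagarias, J. Number Theory 77 (1999) 274–287, Thm. 1. [BombieriLagarias1999]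
-/

noncomputable section

open Complex Filter Topology Set
open scoped ComplexConjugate ComplexOrder

namespace Literature.NumberTheory.LFunctions

namespace LiDirichlet

open ExplicitPsiChar DirichletTheta

variable {q : ℕ} [NeZero q] {χ : DirichletCharacter ℂ q}

/-! ### Li's partial sums and shells of zeros between two heights -/

/-- A shell lies in the box of its upper height. [folklore] -/
private theorem shell_subset_box (a b : ℝ) : {ρ : ℂ | ρ ∈ charNontrivialZeros χ ∧ a < |ρ.im| ∧ |ρ.im| ≤ b} ⊆ lfunctionZeroBox χ b := by
  intro ρ hρ
  rw [lfunctionZeroBox_eq_inter]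
  exact ⟨hρ.1, hρ.2.2⟩

/-- Shells are finite (`χ ≠ χ₀`). [folklore] -/
private theorem shell_finite (hχ : χ ≠ 1) (a b : ℝ) : ({ρ : ℂ | ρ ∈ charNontrivialZeros χ ∧ a < |ρ.im| ∧ |ρ.im| ≤ b}).Finite :=
  (lfunctionZeroBox_finite hχ b).subset (shell_subset_box a b)

/-- `box(a) ∪ shell(a, b) = box(b)` for `a ≤ b`. [folklore] -/
private theorem box_union_shell {a b : ℝ} (hab : a ≤ b) :
    lfunctionZeroBox χ a ∪ {ρ : ℂ | ρ ∈ charNontrivialZeros χ ∧ a < |ρ.im| ∧ |ρ.im| ≤ b} = lfunctionZeroBox χ b := by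
  ext ρ
  rw [lfunctionZeroBox_eq_inter, lfunctionZeroBox_eq_inter]
  simp only [mem_union, mem_inter_iff, mem_setOf_eq]
  constructor
  · rintro (⟨h, h'⟩ | ⟨h, -, h'⟩)
    · exact ⟨h, h'.trans hab⟩
    · exact ⟨h, h'⟩
  · rintro ⟨h, h'⟩
    rcases le_or_gt |ρ.im| a with h1 | h1
    · exact Or.inl ⟨h, h1⟩
    · exact Or.inr ⟨h, h1, h'⟩

/-- `box(a)` and `shell(a, b)` are disjoint. [folklore] -/
private theorem disjoint_box_shell (a b : ℝ) : Disjoint (lfunctionZeroBox χ a) {ρ : ℂ | ρ ∈ charNontrivialZeros χ ∧ a < |ρ.im| ∧ |ρ.im| ≤ b} := by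
  rw [Set.disjoint_left]
  intro ρ hρ hρ'
  rw [lfunctionZeroBox_eq_inter] at hρ
  have h1 : |ρ.im| ≤ a := hρ.2
  exact absurd hρ'.2.1 (not_lt.2 h1)

/-- `shell(a, b) ∪ shell(b, c) = shell(a, c)` for `a ≤ b ≤ c`. [folklore] -/
private theorem shell_union_shell {a b c : ℝ} (hab : a ≤ b) (hbc : b ≤ c) :
    {ρ : ℂ | ρ ∈ charNontrivialZeros χ ∧ a < |ρ.im| ∧ |ρ.im| ≤ b} ∪
      {ρ : ℂ | ρ ∈ charNontrivialZeros χ ∧ b < |ρ.im| ∧ |ρ.im| ≤ c} =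
      {ρ : ℂ | ρ ∈ charNontrivialZeros χ ∧ a < |ρ.im| ∧ |ρ.im| ≤ c} := by
  ext ρ
  simp only [mem_union, mem_setOf_eq]
  constructor
  · rintro (⟨h, h1, h2⟩ | ⟨h, h1, h2⟩)
    · exact ⟨h, h1, h2.trans hbc⟩
    · exact ⟨h, lt_of_le_of_lt hab h1, h2⟩
  · rintro ⟨h, h1, h2⟩
    rcases le_or_gt |ρ.im| b with h3 | h3
    · exact Or.inl ⟨h, h1, h3⟩
    · exact Or.inr ⟨h, h3, h2⟩

/-- Consecutive shells are disjoint. [folklore] -/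
private theorem disjoint_shell_shell (a b c : ℝ) : Disjoint {ρ : ℂ | ρ ∈ charNontrivialZeros χ ∧ a < |ρ.im| ∧ |ρ.im| ≤ b}
      {ρ : ℂ | ρ ∈ charNontrivialZeros χ ∧ b < |ρ.im| ∧ |ρ.im| ≤ c} := by
  rw [Set.disjoint_left]
  intro ρ h h'
  exact absurd h'.2.1 (not_lt.2 h.2.2)

/-- `P(b) − P(a)` is the sum over the shell `a < |Im ρ| ≤ b`. [folklore] -/
private theorem liPartialSum_sub (hχ : χ ≠ 1) (n : ℕ) {a b : ℝ} (hab : a ≤ b) :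
    (∑ᶠ ρ ∈ lfunctionZeroBox χ b, (DirichletDisc.zeroOrder χ ρ : ℂ) * (1 - (1 - 1 / ρ) ^ n)) -
      (∑ᶠ ρ ∈ lfunctionZeroBox χ a, (DirichletDisc.zeroOrder χ ρ : ℂ) * (1 - (1 - 1 / ρ) ^ n)) =
      ∑ ρ ∈ (shell_finite hχ a b).toFinset,
        (DirichletDisc.zeroOrder χ ρ : ℂ) * (1 - (1 - 1 / ρ) ^ n) := by
  rw [← box_union_shell hab,
    finsum_mem_union (disjoint_box_shell a b) (lfunctionZeroBox_finite hχ a) (shell_finite hχ a b),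
    add_sub_cancel_left, finsum_mem_eq_finite_toFinset_sum _ (shell_finite hχ a b)]

/-- `‖P(b) − P(a)‖ ≤ Σ_{a < |Im ρ| ≤ b} m(ρ)‖1 − (1 − 1/ρ)ⁿ‖`. [folklore] -/
private theorem norm_liPartialSum_sub_le (hχ : χ ≠ 1) (n : ℕ) {a b : ℝ} (hab : a ≤ b) :
    ‖(∑ᶠ ρ ∈ lfunctionZeroBox χ b, (DirichletDisc.zeroOrder χ ρ : ℂ) * (1 - (1 - 1 / ρ) ^ n)) -
      (∑ᶠ ρ ∈ lfunctionZeroBox χ a, (DirichletDisc.zeroOrder χ ρ : ℂ) * (1 - (1 - 1 / ρ) ^ n))‖ ≤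
      ∑ ρ ∈ (shell_finite hχ a b).toFinset,
        (DirichletDisc.zeroOrder χ ρ : ℝ) * ‖1 - (1 - 1 / ρ) ^ n‖ := by
  rw [liPartialSum_sub hχ n hab]
  refine (norm_sum_le _ _).trans (le_of_eq (Finset.sum_congr rfl fun ρ _ ↦ ?_))
  rw [norm_mul, Complex.norm_natCast]

/-- Shell sums telescope along a monotone sequence of heights. [folklore] -/
private theorem sum_Ico_shell_eq {M : Type*} [AddCommMonoid M] (hχ : χ ≠ 1) {t : ℕ → ℝ}
    (ht : Monotone t) (f : ℂ → M) (K₁ : ℕ) :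
    ∀ j, K₁ ≤ j → ∑ k ∈ Finset.Ico K₁ j, ∑ ρ ∈ (shell_finite hχ (t k) (t (k + 1))).toFinset, f ρ =
      ∑ ρ ∈ (shell_finite hχ (t K₁) (t j)).toFinset, f ρ := by
  classical
  intro j hj
  induction j, hj using Nat.le_induction with
  | base =>
    rw [Finset.Ico_self, Finset.sum_empty]
    refine (Finset.sum_eq_zero fun ρ hρ ↦ ?_).symm
    obtain ⟨-, h1, h2⟩ := (Set.Finite.mem_toFinset _).1 hρ
    exact absurd h1 (not_lt.2 h2)
  | succ j hj ih =>
    rw [Finset.sum_Ico_succ_top hj, ih,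
      ← Finset.sum_union ((Set.Finite.disjoint_toFinset).2 (disjoint_shell_shell _ _ _))]
    refine Finset.sum_congr ?_ fun _ _ ↦ rfl
    ext ρ
    simp only [Finset.mem_union, Set.Finite.mem_toFinset]
    rw [← Set.mem_union, shell_union_shell (ht hj) (ht j.le_succ)]

/-! ### Elementary estimates for one zero -/

/-- `‖(1 − w)ⁿ − 1 + n w‖ ≤ (2ⁿ − n − 1)‖w‖²` for `‖w‖ ≤ 1` (the binomial tail). [folklore] -/
private theorem norm_one_sub_pow_sub_le {w : ℂ} (hw : ‖w‖ ≤ 1) (n : ℕ) :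
    ‖(1 - w) ^ n - 1 + n * w‖ ≤ (2 ^ n - n - 1) * ‖w‖ ^ 2 := by
  induction n with
  | zero => simp
  | succ n ih =>
    have hn : (n : ℝ) + 1 ≤ 2 ^ n := by
      exact_mod_cast Nat.succ_le_of_lt (Nat.lt_two_pow_self (n := n))
    have e : (1 - w) ^ (n + 1) - 1 + ((n + 1 : ℕ) : ℂ) * w =
        (1 - w) * ((1 - w) ^ n - 1 + n * w) + n * w ^ 2 := by
      push_cast; ring
    rw [e]
    have h1 : ‖1 - w‖ ≤ 2 := (norm_sub_le _ _).trans (by rw [norm_one]; linarith)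
    calc ‖(1 - w) * ((1 - w) ^ n - 1 + n * w) + n * w ^ 2‖
        ≤ ‖1 - w‖ * ‖(1 - w) ^ n - 1 + n * w‖ + n * ‖w‖ ^ 2 := by
          refine (norm_add_le _ _).trans (le_of_eq ?_)
          rw [norm_mul, norm_mul, norm_pow, Complex.norm_natCast]
      _ ≤ 2 * ((2 ^ n - n - 1) * ‖w‖ ^ 2) + n * ‖w‖ ^ 2 := by
          have := mul_le_mul h1 ih (norm_nonneg _) (by norm_num)
          linarith
      _ = (2 ^ (n + 1) - ((n + 1 : ℕ) : ℝ) - 1) * ‖w‖ ^ 2 := by push_cast; ring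

/-- Real-variable core of the block estimate: for `k ≥ 1`, `k < g ≤ k + 2`, `0 ≤ x < 1`,
`|1/k − g/(x + g²)| ≤ 3/k²`. [folklore] -/
private theorem abs_inv_sub_div_le {k : ℕ} (hk : 1 ≤ k) {g x : ℝ} (hx0 : 0 ≤ x) (hx1 : x < 1)
    (hlo : (k : ℝ) < g) (hhi : g ≤ k + 2) :
    |1 / (k : ℝ) - g / (x + g ^ 2)| ≤ 3 / (k : ℝ) ^ 2 := by
  have hk' : (1 : ℝ) ≤ k := by exact_mod_cast hk
  have hkpos : (0 : ℝ) < k := by linarith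
  have hg1 : 1 ≤ g := by linarith
  have hgpos : 0 < g := by linarith
  have hN : 0 < x + g ^ 2 := by positivity
  rw [div_sub_div _ _ hkpos.ne' hN.ne', abs_div, abs_of_pos (mul_pos hkpos hN),
    div_le_div_iff₀ (mul_pos hkpos hN) (by positivity)]
  have hgk : g * (g - k) ≤ g * 2 := mul_le_mul_of_nonneg_left (by linarith) hgpos.le
  have hgk' : 0 < (g - k) * g := mul_pos (sub_pos.2 hlo) hgpos
  have hnum : |1 * (x + g ^ 2) - (k : ℝ) * g| ≤ 3 * g := by
    rw [abs_le]
    constructor <;> nlinarith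
  have hkg : g * (k : ℝ) ≤ g * g := mul_le_mul_of_nonneg_left hlo.le hgpos.le
  calc |1 * (x + g ^ 2) - (k : ℝ) * g| * (k : ℝ) ^ 2 ≤ 3 * g * (k : ℝ) ^ 2 := by gcongr
    _ ≤ 3 * ((k : ℝ) * (x + g ^ 2)) := by nlinarith [mul_nonneg hkpos.le hx0]

/-- **Per-zero block estimate.**  For `ρ = β + iγ` with `0 < β < 1` and `k < |γ| ≤ k + 2` (`k ≥ 1`):
`‖[1 − (1 − 1/ρ)ⁿ] + i n sign(γ)/k‖ ≤ (4n + 2ⁿ)/k²` — i.e. up to `O(1/k²)` the term is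
`−i n sign(γ)/k` (`1/ρ = (β − iγ)/|ρ|²`). [folklore] -/
private theorem norm_term_add_le {k : ℕ} (hk : 1 ≤ k) {ρ : ℂ} (h0 : 0 < ρ.re) (h1 : ρ.re < 1)
    (hlo : (k : ℝ) < |ρ.im|) (hhi : |ρ.im| ≤ k + 2) (n : ℕ) :
    ‖(1 - (1 - 1 / ρ) ^ n) + I * n * Real.sign ρ.im / k‖ ≤ (4 * n + 2 ^ n) / (k : ℝ) ^ 2 := by
  have hk' : (1 : ℝ) ≤ k := by exact_mod_cast hk
  have hkpos : (0 : ℝ) < k := by linarith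
  have hg1 : 1 ≤ |ρ.im| := by linarith
  have hρ0 : ρ ≠ 0 := fun h ↦ by rw [h] at h0; simp at h0
  have hγ0 : ρ.im ≠ 0 := fun h ↦ by rw [h, abs_zero] at hlo; linarith
  have hnorm : |ρ.im| ≤ ‖ρ‖ := Complex.abs_im_le_norm ρ
  -- real and imaginary parts of `w = 1/ρ`
  have hN : Complex.normSq ρ = ρ.re ^ 2 + ρ.im ^ 2 := by rw [Complex.normSq_apply]; ring
  have hNpos : 0 < Complex.normSq ρ := Complex.normSq_pos.2 hρ0
  have hre : (1 / ρ).re = ρ.re / Complex.normSq ρ := by rw [one_div, Complex.inv_re]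
  have him : (1 / ρ).im = -ρ.im / Complex.normSq ρ := by rw [one_div, Complex.inv_im]
  set w : ℂ := 1 / ρ with hw
  have hw_norm : ‖w‖ = 1 / ‖ρ‖ := by rw [hw, norm_div, norm_one]
  have hw_le : ‖w‖ ≤ 1 / |ρ.im| := by
    rw [hw_norm]; exact one_div_le_one_div_of_le (by linarith) hnorm
  have hw_le_k : ‖w‖ ≤ 1 / k := hw_le.trans (one_div_le_one_div_of_le hkpos hlo.le)
  have hw1 : ‖w‖ ≤ 1 := hw_le_k.trans (by rw [div_le_one hkpos]; exact hk')
  -- the decomposition `term + i n s/k = n (w + i s/k) − [(1 − w)ⁿ − 1 + n w]`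
  have e : (1 - (1 - w) ^ n) + I * n * Real.sign ρ.im / k =
      n * (w + I * Real.sign ρ.im / k) - ((1 - w) ^ n - 1 + n * w) := by ring
  rw [e]
  have hR := norm_one_sub_pow_sub_le hw1 n
  have hγ2 : (k : ℝ) ^ 2 < ρ.im ^ 2 := by
    have : (k : ℝ) ^ 2 < |ρ.im| ^ 2 := by nlinarith [abs_nonneg ρ.im]
    rwa [sq_abs] at this
  have hre_bd : |w.re| ≤ 1 / (k : ℝ) ^ 2 := by
    rw [hre, abs_of_nonneg (div_nonneg h0.le hNpos.le),
      div_le_div_iff₀ hNpos (by positivity), one_mul]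
    nlinarith [mul_le_mul_of_nonneg_right h1.le (sq_nonneg (k : ℝ)), sq_nonneg ρ.re, hγ2, hN]
  have him_bd : |w.im + Real.sign ρ.im / k| ≤ 3 / (k : ℝ) ^ 2 := by
    have key := abs_inv_sub_div_le hk (sq_nonneg ρ.re) (by nlinarith : ρ.re ^ 2 < 1) hlo hhi
    rw [sq_abs, ← hN] at key
    rw [him]
    rcases hγ0.lt_or_gt with hneg | hpos
    · rw [Real.sign_of_neg hneg]
      rw [abs_of_neg hneg] at key
      have : -ρ.im / Complex.normSq ρ + (-1 : ℝ) / k = -(1 / k - -ρ.im / Complex.normSq ρ) := by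
        ring
      rw [this, abs_neg]
      exact key
    · rw [Real.sign_of_pos hpos]
      rw [abs_of_pos hpos] at key
      have : -ρ.im / Complex.normSq ρ + (1 : ℝ) / k = 1 / k - ρ.im / Complex.normSq ρ := by ring
      rw [this]
      exact key
  have hws : ‖w + I * Real.sign ρ.im / k‖ ≤ 4 / (k : ℝ) ^ 2 := by
    have ei : w + I * (Real.sign ρ.im : ℂ) / (k : ℂ) = w + ((Real.sign ρ.im / k : ℝ) : ℂ) * I := by
      push_cast; ring
    refine (Complex.norm_le_abs_re_add_abs_im _).trans ?_
    have e1 : (w + I * (Real.sign ρ.im : ℂ) / (k : ℂ)).re = w.re := by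
      rw [ei]; simp
    have e2 : (w + I * (Real.sign ρ.im : ℂ) / (k : ℂ)).im = w.im + Real.sign ρ.im / k := by
      rw [ei]; simp
    rw [e1, e2, show (4 : ℝ) / (k : ℝ) ^ 2 = 1 / (k : ℝ) ^ 2 + 3 / (k : ℝ) ^ 2 by ring]
    exact add_le_add hre_bd him_bd
  calc ‖(n : ℂ) * (w + I * Real.sign ρ.im / k) - ((1 - w) ^ n - 1 + n * w)‖
      ≤ ‖(n : ℂ) * (w + I * Real.sign ρ.im / k)‖ + ‖(1 - w) ^ n - 1 + n * w‖ := norm_sub_le _ _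
    _ ≤ n * (4 / (k : ℝ) ^ 2) + 2 ^ n / (k : ℝ) ^ 2 := by
        refine add_le_add ?_ ?_
        · rw [norm_mul, Complex.norm_natCast]
          exact mul_le_mul_of_nonneg_left hws (Nat.cast_nonneg n)
        · calc ‖(1 - w) ^ n - 1 + n * w‖ ≤ (2 ^ n - n - 1) * ‖w‖ ^ 2 := hR
            _ ≤ 2 ^ n * ‖w‖ ^ 2 := by
                gcongr; linarith [(n.cast_nonneg : (0 : ℝ) ≤ n)]
            _ ≤ 2 ^ n * (1 / k) ^ 2 := by gcongr
            _ = 2 ^ n / (k : ℝ) ^ 2 := by ring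
    _ = (4 * n + 2 ^ n) / (k : ℝ) ^ 2 := by ring

/-- **Per-zero size estimate.**  For `ρ = β + iγ` with `0 < β` and `|γ| ≥ K ≥ 1`:
`‖1 − (1 − 1/ρ)ⁿ‖ ≤ (n + 2ⁿ)/K`. [folklore] -/
private theorem norm_term_le {K : ℕ} (hK : 1 ≤ K) {ρ : ℂ} (h0 : 0 < ρ.re)
    (hlo : (K : ℝ) ≤ |ρ.im|) (n : ℕ) :
    ‖1 - (1 - 1 / ρ) ^ n‖ ≤ (n + 2 ^ n) / (K : ℝ) := by
  have hK' : (1 : ℝ) ≤ K := by exact_mod_cast hK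
  have hKpos : (0 : ℝ) < K := by linarith
  have hρ0 : ρ ≠ 0 := fun h ↦ by rw [h] at h0; simp at h0
  have hnorm : |ρ.im| ≤ ‖ρ‖ := Complex.abs_im_le_norm ρ
  set w : ℂ := 1 / ρ with hw
  have hw_norm : ‖w‖ = 1 / ‖ρ‖ := by rw [hw, norm_div, norm_one]
  have hw_le_K : ‖w‖ ≤ 1 / K := by
    rw [hw_norm]; exact one_div_le_one_div_of_le hKpos (hlo.trans hnorm)
  have hk1 : 1 / (K : ℝ) ≤ 1 := by rw [div_le_one hKpos]; exact hK'
  have hw1 : ‖w‖ ≤ 1 := hw_le_K.trans hk1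
  have e : 1 - (1 - w) ^ n = n * w - ((1 - w) ^ n - 1 + n * w) := by ring
  rw [e]
  calc ‖(n : ℂ) * w - ((1 - w) ^ n - 1 + n * w)‖
      ≤ ‖(n : ℂ) * w‖ + ‖(1 - w) ^ n - 1 + n * w‖ := norm_sub_le _ _
    _ ≤ n * (1 / K) + 2 ^ n * (1 / K) := by
        refine add_le_add ?_ ?_
        · rw [norm_mul, Complex.norm_natCast]
          exact mul_le_mul_of_nonneg_left hw_le_K (Nat.cast_nonneg n)
        · calc ‖(1 - w) ^ n - 1 + n * w‖ ≤ (2 ^ n - n - 1) * ‖w‖ ^ 2 :=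
              norm_one_sub_pow_sub_le hw1 n
            _ ≤ 2 ^ n * ‖w‖ ^ 2 := by
                gcongr; linarith [(n.cast_nonneg : (0 : ℝ) ≤ n)]
            _ ≤ 2 ^ n * (1 / K) ^ 2 := by gcongr
            _ ≤ 2 ^ n * (1 / K) := by
                rw [sq]
                exact mul_le_mul_of_nonneg_left (mul_le_of_le_one_left (by positivity) hk1)
                  (by positivity)
    _ = (n + 2 ^ n) / (K : ℝ) := by ring

/-! ### Zeros in two unit windows (MV Theorem 10.17) -/

/-- `Σ_{s ∪ t} f ≤ Σ_s f + Σ_t f` for a non-negative `f`. [folklore] -/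
private theorem sum_union_le' [DecidableEq ℂ] (s t : Finset ℂ) {f : ℂ → ℝ} (hf : ∀ x, 0 ≤ f x) :
    ∑ x ∈ s ∪ t, f x ≤ ∑ x ∈ s, f x + ∑ x ∈ t, f x := by
  rw [← Finset.sum_union_inter]
  exact le_add_of_nonneg_right (Finset.sum_nonneg fun x _ ↦ hf x)

/-- **Zeros with `k ≤ |Im ρ| ≤ k + 2` have total multiplicity `≤ 4C(log q + log(k + 6))`**, from the
unit-window bound `Σ_{|γ − τ| ≤ 1/2} m(ρ) ≤ C(log q + log(|τ| + 4))` of the tree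
(`ExplicitPsiChar.exists_sum_window_le`, MV Thm 10.17) at the four centres `±(k + 1/2)`, `±(k + 3/2)`.
[cite: MontgomeryVaughan2007, Theorem 10.17] -/
theorem sum_zeroOrder_le_of_abs_im_mem {C : ℝ} (hC0 : 0 ≤ C)
    (hC : ∀ (τ : ℝ) (P : Finset ℂ),
        (∀ ρ ∈ P, χ.LFunction ρ = 0 ∧ 0 < ρ.re ∧ ρ.re < 1 ∧ |ρ.im - τ| ≤ 1 / 2) →
        ∑ ρ ∈ P, (DirichletDisc.zeroOrder χ ρ : ℝ) ≤ C * (Real.log q + Real.log (|τ| + 4)))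
    (k : ℕ) (P : Finset ℂ)
    (hP : ∀ ρ ∈ P, ρ ∈ charNontrivialZeros χ ∧ (k : ℝ) ≤ |ρ.im| ∧ |ρ.im| ≤ k + 2) :
    ∑ ρ ∈ P, (DirichletDisc.zeroOrder χ ρ : ℝ) ≤ 4 * C * (Real.log q + Real.log (k + 6)) := by
  classical
  set f : ℂ → ℝ := fun ρ ↦ (DirichletDisc.zeroOrder χ ρ : ℝ) with hf_def
  have hf : ∀ ρ, 0 ≤ f ρ := fun ρ ↦ Nat.cast_nonneg _
  set τ₁ : ℝ := k + 1 / 2 with hτ₁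
  set τ₂ : ℝ := k + 3 / 2 with hτ₂
  set P₁ := P.filter (fun ρ ↦ |ρ.im - τ₁| ≤ 1 / 2) with hP₁
  set P₂ := P.filter (fun ρ ↦ |ρ.im - τ₂| ≤ 1 / 2) with hP₂
  set P₃ := P.filter (fun ρ ↦ |ρ.im - (-τ₁)| ≤ 1 / 2) with hP₃
  set P₄ := P.filter (fun ρ ↦ |ρ.im - (-τ₂)| ≤ 1 / 2) with hP₄
  have hcover : P ⊆ P₁ ∪ P₂ ∪ P₃ ∪ P₄ := by
    intro ρ hρ
    obtain ⟨-, hlo, hhi⟩ := hP ρ hρ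
    simp only [Finset.mem_union, Finset.mem_filter, hP₁, hP₂, hP₃, hP₄, hτ₁, hτ₂]
    rcases le_or_gt 0 ρ.im with h | h
    · rw [abs_of_nonneg h] at hlo hhi
      rcases le_or_gt ρ.im (k + 1) with h' | h'
      · exact Or.inl (Or.inl (Or.inl ⟨hρ, abs_le.2 ⟨by linarith, by linarith⟩⟩))
      · exact Or.inl (Or.inl (Or.inr ⟨hρ, abs_le.2 ⟨by linarith, by linarith⟩⟩))
    · rw [abs_of_neg h] at hlo hhi
      rcases le_or_gt (-ρ.im) (k + 1) with h' | h'
      · exact Or.inl (Or.inr ⟨hρ, abs_le.2 ⟨by linarith, by linarith⟩⟩)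
      · exact Or.inr ⟨hρ, abs_le.2 ⟨by linarith, by linarith⟩⟩
  have hwin : ∀ (τ : ℝ) (Q : Finset ℂ), Q ⊆ P → (∀ ρ ∈ Q, |ρ.im - τ| ≤ 1 / 2) →
      |τ| + 4 ≤ k + 6 → ∑ ρ ∈ Q, f ρ ≤ C * (Real.log q + Real.log (k + 6)) := by
    intro τ Q hQ hτQ hτ
    refine (hC τ Q fun ρ hρ ↦ ?_).trans ?_
    · obtain ⟨⟨hz, h0, h1⟩, -⟩ := hP ρ (hQ hρ)
      exact ⟨hz, h0, h1, hτQ ρ hρ⟩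
    · have hpos : 0 < |τ| + 4 := by positivity
      have := Real.log_le_log hpos hτ
      exact mul_le_mul_of_nonneg_left (by linarith) hC0
  have h1 := hwin τ₁ P₁ (Finset.filter_subset _ _) (fun ρ hρ ↦ (Finset.mem_filter.1 hρ).2)
    (by rw [hτ₁, abs_of_nonneg (by positivity)]; linarith)
  have h2 := hwin τ₂ P₂ (Finset.filter_subset _ _) (fun ρ hρ ↦ (Finset.mem_filter.1 hρ).2)
    (by rw [hτ₂, abs_of_nonneg (by positivity)]; linarith)
  have h3 := hwin (-τ₁) P₃ (Finset.filter_subset _ _) (fun ρ hρ ↦ (Finset.mem_filter.1 hρ).2)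
    (by rw [abs_neg, hτ₁, abs_of_nonneg (by positivity)]; linarith)
  have h4 := hwin (-τ₂) P₄ (Finset.filter_subset _ _) (fun ρ hρ ↦ (Finset.mem_filter.1 hρ).2)
    (by rw [abs_neg, hτ₂, abs_of_nonneg (by positivity)]; linarith)
  have u1 := sum_union_le' (P₁ ∪ P₂ ∪ P₃) P₄ hf
  have u2 := sum_union_le' (P₁ ∪ P₂) P₃ hf
  have u3 := sum_union_le' P₁ P₂ hf
  calc ∑ ρ ∈ P, f ρ ≤ ∑ ρ ∈ P₁ ∪ P₂ ∪ P₃ ∪ P₄, f ρ :=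
        Finset.sum_le_sum_of_subset_of_nonneg hcover (fun ρ _ _ ↦ hf ρ)
    _ ≤ 4 * C * (Real.log q + Real.log (k + 6)) := by linarith

/-! ### The signed zero count between two heights (MV Theorem 14.5, both signs) -/

/-- The `S`-majorant `B_q(t) = 5/2 + log(2q(t + 4)ζ(5/4))/log(7/6)` of the tree's
`DirichletTheta.abs_dirichletArgS_le` (MV Lemma 12.8, explicit) splits as
`B_q(t) = A_q + log(t + 4)/log(7/6)`, `A_q = 5/2 + log(2qζ(5/4))/log(7/6)` (`t ≥ 0`).
[cite: MontgomeryVaughan2007, Lemma 12.8] -/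
theorem argSBound_eq {t : ℝ} (ht : 0 ≤ t) :
    (5 / 2 + Real.log (2 * ((q : ℝ) * (t + 4) * DirichletDisc.Zc)) / Real.log (7 / 6)) =
      (5 / 2 + Real.log (2 * (q : ℝ) * DirichletDisc.Zc) / Real.log (7 / 6)) +
        (1 / Real.log (7 / 6)) * Real.log (t + 4) := by
  have hq : (0 : ℝ) < q := by exact_mod_cast NeZero.pos q
  have hZ : 0 < DirichletDisc.Zc := lt_of_lt_of_le one_pos DirichletDisc.one_le_Zc
  rw [show 2 * ((q : ℝ) * (t + 4) * DirichletDisc.Zc) =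
      (2 * (q : ℝ) * DirichletDisc.Zc) * (t + 4) by ring,
    Real.log_mul (by positivity) (by linarith)]
  ring

/-- `0 ≤ A_q` (indeed `2qζ(5/4) ≥ 2`). [cite: MontgomeryVaughan2007, Lemma 12.8] -/
theorem argSConst_nonneg :
    0 ≤ (5 / 2 + Real.log (2 * (q : ℝ) * DirichletDisc.Zc) / Real.log (7 / 6)) := by
  have hq1 : (1 : ℝ) ≤ q := by exact_mod_cast NeZero.one_le
  have h76 : 0 < Real.log (7 / 6) := Real.log_pos (by norm_num)
  have : 0 ≤ Real.log (2 * (q : ℝ) * DirichletDisc.Zc) :=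
    Real.log_nonneg (by nlinarith [DirichletDisc.one_le_Zc])
  exact add_nonneg (by norm_num) (div_nonneg this h76.le)

/-- `B_q(t) ≥ 0` for `t ≥ 0`. [cite: MontgomeryVaughan2007, Lemma 12.8] -/
theorem argSBound_nonneg {t : ℝ} (ht : 0 ≤ t) :
    0 ≤ (5 / 2 + Real.log (2 * ((q : ℝ) * (t + 4) * DirichletDisc.Zc)) / Real.log (7 / 6)) := by
  rw [argSBound_eq ht]
  have h76 : 0 < Real.log (7 / 6) := Real.log_pos (by norm_num)
  have : 0 ≤ Real.log (t + 4) := Real.log_nonneg (by linarith)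
  exact add_nonneg argSConst_nonneg (mul_nonneg (by positivity) this)

/-- `B_q` is monotone on `t ≥ 0`. [cite: MontgomeryVaughan2007, Lemma 12.8] -/
theorem argSBound_mono {s t : ℝ} (hs : 0 ≤ s) (hst : s ≤ t) :
    (5 / 2 + Real.log (2 * ((q : ℝ) * (s + 4) * DirichletDisc.Zc)) / Real.log (7 / 6)) ≤
      (5 / 2 + Real.log (2 * ((q : ℝ) * (t + 4) * DirichletDisc.Zc)) / Real.log (7 / 6)) := by
  rw [argSBound_eq hs, argSBound_eq (hs.trans hst)]
  have h76 : 0 < Real.log (7 / 6) := Real.log_pos (by norm_num)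
  have := Real.log_le_log (by linarith : 0 < s + 4) (by linarith : s + 4 ≤ t + 4)
  have h1 : 0 ≤ 1 / Real.log (7 / 6) := by positivity
  linarith [mul_le_mul_of_nonneg_left this h1]

/-- **The signed zero count between two heights** (MV Theorem 14.5 applied on `(a, b)` and on
`(−b, −a)`; p. 454: «the number of zeros of `L(s, χ)` with `−T ≤ γ ≤ 0` is `N(T, χ̄)`»).  For a
primitive `χ` mod `q > 1` and heights `a < b` such that `±a, ±b` are ordinates of no non-trivial zero,
the `Γ`-phase (odd in `t`) and the `(t/2) log q` terms cancel and
`#{ρ : a < γ < b} − #{ρ : −b < γ < −a} = S(b, χ) − S(a, χ) − S(−a, χ) + S(−b, χ)`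
(multiplicities `m_χ = DirichletDisc.zeroOrder χ`). [cite: MontgomeryVaughan2007, Theorem 14.5] -/
theorem finsum_zeroOrder_sub_finsum_zeroOrder_neg_eq (hχ : χ.IsPrimitive) (hq : 1 < q) {a b : ℝ}
    (hab : a < b) (ha : ∀ ρ ∈ charNontrivialZeros χ, ρ.im ≠ a)
    (ha' : ∀ ρ ∈ charNontrivialZeros χ, ρ.im ≠ -a) (hb : ∀ ρ ∈ charNontrivialZeros χ, ρ.im ≠ b)
    (hb' : ∀ ρ ∈ charNontrivialZeros χ, ρ.im ≠ -b) :
    ((∑ᶠ ρ ∈ {ρ : ℂ | ρ ∈ charNontrivialZeros χ ∧ a < ρ.im ∧ ρ.im < b},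
        DirichletDisc.zeroOrder χ ρ : ℕ) : ℝ) -
      ((∑ᶠ ρ ∈ {ρ : ℂ | ρ ∈ charNontrivialZeros χ ∧ -b < ρ.im ∧ ρ.im < -a},
        DirichletDisc.zeroOrder χ ρ : ℕ) : ℝ) =
      dirichletArgS χ b - dirichletArgS χ a - dirichletArgS χ (-a) + dirichletArgS χ (-b) := by
  have hq1 : q ≠ 1 := by omega
  have h1 := pi_mul_finsum_zeroOrder_eq hχ hq1 hab ha hb
  have h2 := pi_mul_finsum_zeroOrder_eq hχ hq1 (neg_lt_neg hab) hb' ha'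
  rw [gammaArgPhase_neg, gammaArgPhase_neg] at h2
  have hπ := Real.pi_pos
  refine mul_left_cancel₀ hπ.ne' ?_
  rw [mul_sub, h1, h2]
  ring

/-- **`|N⁺ − N⁻| ≤ 4 B_q(b)`**: the signed count between admissible heights `0 ≤ a < b` is bounded by
four `S`-bounds (MV Theorem 14.5 + Lemma 12.8; Cor. 14.7's `O(log qT)` for the DIFFERENCE of the
upper and lower counts, in which the main terms cancel). [cite: MontgomeryVaughan2007, Corollary 14.7] -/
theorem abs_finsum_zeroOrder_sub_finsum_zeroOrder_neg_le (hχ : χ.IsPrimitive) (hq : 1 < q)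
    {a b : ℝ} (h0 : 0 ≤ a) (hab : a < b) (ha : ∀ ρ ∈ charNontrivialZeros χ, ρ.im ≠ a)
    (ha' : ∀ ρ ∈ charNontrivialZeros χ, ρ.im ≠ -a) (hb : ∀ ρ ∈ charNontrivialZeros χ, ρ.im ≠ b)
    (hb' : ∀ ρ ∈ charNontrivialZeros χ, ρ.im ≠ -b) :
    |((∑ᶠ ρ ∈ {ρ : ℂ | ρ ∈ charNontrivialZeros χ ∧ a < ρ.im ∧ ρ.im < b},
        DirichletDisc.zeroOrder χ ρ : ℕ) : ℝ) -
      ((∑ᶠ ρ ∈ {ρ : ℂ | ρ ∈ charNontrivialZeros χ ∧ -b < ρ.im ∧ ρ.im < -a},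
        DirichletDisc.zeroOrder χ ρ : ℕ) : ℝ)| ≤
      4 * (5 / 2 + Real.log (2 * ((q : ℝ) * (b + 4) * DirichletDisc.Zc)) / Real.log (7 / 6)) := by
  rw [finsum_zeroOrder_sub_finsum_zeroOrder_neg_eq hχ hq hab ha ha' hb hb']
  have h1 : χ ≠ 1 := ne_one_of_isPrimitive hχ hq
  have hb0 : 0 ≤ b := h0.trans hab.le
  have e1 : |dirichletArgS χ b| ≤ (5 / 2 + Real.log (2 * ((q : ℝ) * (b + 4) * DirichletDisc.Zc)) / Real.log (7 / 6)) := by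
    have := abs_dirichletArgS_le h1 hb; rwa [abs_of_nonneg hb0] at this
  have e2 : |dirichletArgS χ a| ≤ (5 / 2 + Real.log (2 * ((q : ℝ) * (a + 4) * DirichletDisc.Zc)) / Real.log (7 / 6)) := by
    have := abs_dirichletArgS_le h1 ha; rwa [abs_of_nonneg h0] at this
  have e3 : |dirichletArgS χ (-a)| ≤ (5 / 2 + Real.log (2 * ((q : ℝ) * (a + 4) * DirichletDisc.Zc)) / Real.log (7 / 6)) := by
    have := abs_dirichletArgS_le h1 ha'; rwa [abs_neg, abs_of_nonneg h0] at this
  have e4 : |dirichletArgS χ (-b)| ≤ (5 / 2 + Real.log (2 * ((q : ℝ) * (b + 4) * DirichletDisc.Zc)) / Real.log (7 / 6)) := by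
    have := abs_dirichletArgS_le h1 hb'; rwa [abs_neg, abs_of_nonneg hb0] at this
  have m := argSBound_mono (q := q) h0 hab.le
  calc |dirichletArgS χ b - dirichletArgS χ a - dirichletArgS χ (-a) + dirichletArgS χ (-b)|
      ≤ |dirichletArgS χ b - dirichletArgS χ a - dirichletArgS χ (-a)| + |dirichletArgS χ (-b)| :=
        abs_add_le _ _
    _ ≤ |dirichletArgS χ b - dirichletArgS χ a| + |dirichletArgS χ (-a)| +
          |dirichletArgS χ (-b)| := by
        linarith [abs_sub (dirichletArgS χ b - dirichletArgS χ a) (dirichletArgS χ (-a))]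
    _ ≤ |dirichletArgS χ b| + |dirichletArgS χ a| + |dirichletArgS χ (-a)| +
          |dirichletArgS χ (-b)| := by
        linarith [abs_sub (dirichletArgS χ b) (dirichletArgS χ a)]
    _ ≤ 4 * (5 / 2 + Real.log (2 * ((q : ℝ) * (b + 4) * DirichletDisc.Zc)) / Real.log (7 / 6)) := by linarith

/-- The signed shell sum `Σ_{a < |γ| ≤ b} m(ρ) sign(γ)` is the signed count `N⁺ − N⁻` of the previous
lemmas (`0 ≤ a`, `±b` ordinates of no zero). [folklore] -/
private theorem sum_shell_mul_sign_eq (hχ : χ ≠ 1) {a b : ℝ} (h0 : 0 ≤ a)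
    (hb : ∀ ρ ∈ charNontrivialZeros χ, ρ.im ≠ b) (hb' : ∀ ρ ∈ charNontrivialZeros χ, ρ.im ≠ -b) :
    ∑ ρ ∈ (shell_finite hχ a b).toFinset, (DirichletDisc.zeroOrder χ ρ : ℝ) * Real.sign ρ.im =
      ((∑ᶠ ρ ∈ {ρ : ℂ | ρ ∈ charNontrivialZeros χ ∧ a < ρ.im ∧ ρ.im < b},
          DirichletDisc.zeroOrder χ ρ : ℕ) : ℝ) -
        ((∑ᶠ ρ ∈ {ρ : ℂ | ρ ∈ charNontrivialZeros χ ∧ -b < ρ.im ∧ ρ.im < -a},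
          DirichletDisc.zeroOrder χ ρ : ℕ) : ℝ) := by
  classical
  set F := (shell_finite hχ a b).toFinset with hF
  have hmemF : ∀ ρ, ρ ∈ F ↔ ρ ∈ charNontrivialZeros χ ∧ a < |ρ.im| ∧ |ρ.im| ≤ b := fun ρ ↦ by
    rw [hF, Set.Finite.mem_toFinset]; rfl
  have hSp : ({ρ : ℂ | ρ ∈ charNontrivialZeros χ ∧ a < ρ.im ∧ ρ.im < b}).Finite :=
    (lfunctionZeroBox_finite hχ b).subset (by
      rintro ρ ⟨hz, h1, h2⟩
      rw [lfunctionZeroBox_eq_inter]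
      exact ⟨hz, by rw [mem_setOf_eq, abs_le]; constructor <;> linarith⟩)
  have hSm : ({ρ : ℂ | ρ ∈ charNontrivialZeros χ ∧ -b < ρ.im ∧ ρ.im < -a}).Finite :=
    (lfunctionZeroBox_finite hχ b).subset (by
      rintro ρ ⟨hz, h1, h2⟩
      rw [lfunctionZeroBox_eq_inter]
      exact ⟨hz, by rw [mem_setOf_eq, abs_le]; constructor <;> linarith⟩)
  rw [← Finset.sum_filter_add_sum_filter_not F (fun ρ ↦ 0 < ρ.im)]
  have hpos : ∑ ρ ∈ F.filter (fun ρ ↦ 0 < ρ.im), (DirichletDisc.zeroOrder χ ρ : ℝ) * Real.sign ρ.im =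
      ∑ ρ ∈ F.filter (fun ρ ↦ 0 < ρ.im), (DirichletDisc.zeroOrder χ ρ : ℝ) :=
    Finset.sum_congr rfl fun ρ hρ ↦ by rw [Real.sign_of_pos (Finset.mem_filter.1 hρ).2, mul_one]
  have hneg : ∑ ρ ∈ F.filter (fun ρ ↦ ¬ 0 < ρ.im),
        (DirichletDisc.zeroOrder χ ρ : ℝ) * Real.sign ρ.im =
      -∑ ρ ∈ F.filter (fun ρ ↦ ¬ 0 < ρ.im), (DirichletDisc.zeroOrder χ ρ : ℝ) := by
    rw [← Finset.sum_neg_distrib]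
    refine Finset.sum_congr rfl fun ρ hρ ↦ ?_
    obtain ⟨hρF, hn⟩ := Finset.mem_filter.1 hρ
    have hne : ρ.im ≠ 0 := by
      intro h
      have := ((hmemF ρ).1 hρF).2.1
      rw [h, abs_zero] at this
      linarith
    rw [Real.sign_of_neg (lt_of_le_of_ne (not_lt.1 hn) hne), mul_neg, mul_one]
  rw [hpos, hneg, ← sub_eq_add_neg]
  congr 1
  · rw [finsum_mem_eq_finite_toFinset_sum _ hSp, Nat.cast_sum]
    refine Finset.sum_congr ?_ fun _ _ ↦ rfl
    ext ρ
    rw [Finset.mem_filter, hmemF, Set.Finite.mem_toFinset, mem_setOf_eq]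
    constructor
    · rintro ⟨⟨hz, h1, h2⟩, hp⟩
      rw [abs_of_pos hp] at h1 h2
      exact ⟨hz, h1, lt_of_le_of_ne h2 (hb ρ hz)⟩
    · rintro ⟨hz, h1, h2⟩
      have hp : 0 < ρ.im := h0.trans_lt h1
      exact ⟨⟨hz, by rwa [abs_of_pos hp], by rw [abs_of_pos hp]; exact h2.le⟩, hp⟩
  · rw [finsum_mem_eq_finite_toFinset_sum _ hSm, Nat.cast_sum]
    refine Finset.sum_congr ?_ fun _ _ ↦ rfl
    ext ρ
    rw [Finset.mem_filter, hmemF, Set.Finite.mem_toFinset, mem_setOf_eq]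
    constructor
    · rintro ⟨⟨hz, h1, h2⟩, hn⟩
      have hn' : ρ.im ≤ 0 := not_lt.1 hn
      have hne : ρ.im ≠ 0 := by intro h; rw [h, abs_zero] at h1; linarith
      have hlt : ρ.im < 0 := lt_of_le_of_ne hn' hne
      rw [abs_of_neg hlt] at h1 h2
      have h2' : -ρ.im < b := lt_of_le_of_ne h2 (fun h ↦ hb' ρ hz (by linarith))
      exact ⟨hz, by linarith, by linarith⟩
    · rintro ⟨hz, h1, h2⟩
      have hlt : ρ.im < 0 := by linarith
      refine ⟨⟨hz, ?_, ?_⟩, not_lt.2 hlt.le⟩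
      · rw [abs_of_neg hlt]; linarith
      · rw [abs_of_neg hlt]; linarith

/-! ### Abel summation with bounded signed partial sums -/

/-- Abel summation identity for `Σ_{K₁ ≤ k < K₂} d_k/k` (`K₁ ≥ 2`), with `D(j) = Σ_{K₁ ≤ k < j} d_k`:
`Σ d_k/k = D(K₂)/(K₂ − 1) + Σ_{K₁ < j < K₂} D(j)/(j(j − 1))`. [folklore] -/
private theorem abel_identity (d : ℕ → ℝ) {K₁ : ℕ} (hK₁ : 2 ≤ K₁) :
    ∀ K₂, K₁ ≤ K₂ → ∑ k ∈ Finset.Ico K₁ K₂, d k / k =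
      (∑ k ∈ Finset.Ico K₁ K₂, d k) / ((K₂ : ℝ) - 1) +
        ∑ j ∈ Finset.Ico (K₁ + 1) K₂, (∑ k ∈ Finset.Ico K₁ j, d k) / ((j : ℝ) * ((j : ℝ) - 1)) := by
  intro K₂ hK
  induction K₂, hK using Nat.le_induction with
  | base => simp
  | succ K₂ hK ih =>
    have h2 : (2 : ℝ) ≤ K₂ := by exact_mod_cast hK₁.trans hK
    rcases hK.eq_or_lt with heq | hlt
    · subst heq
      rw [Nat.Ico_succ_singleton, Finset.sum_singleton, Finset.sum_singleton, Finset.Ico_self,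
        Finset.sum_empty]
      push_cast
      ring
    · rw [Finset.sum_Ico_succ_top hK, Finset.sum_Ico_succ_top hK,
        Finset.sum_Ico_succ_top (Nat.succ_le_of_lt hlt), ih]
      have hne : (K₂ : ℝ) - 1 ≠ 0 := by linarith
      have hne' : (K₂ : ℝ) ≠ 0 := by linarith
      push_cast
      rw [add_sub_cancel_right]
      field_simp
      ring

/-- Abel summation bound: if the signed partial sums satisfy `|D(j)| ≤ M(j)` with `M ≥ 0`, then for
`K₂ ≥ K₁ ≥ 2`, `|Σ_{K₁ ≤ k < K₂} d_k/k| ≤ 2M(K₂)/K₂ + Σ_{K₁ ≤ k < K₂} M(k + 1)/k²`. [folklore] -/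
private theorem abel_bound (d M : ℕ → ℝ) {K₁ : ℕ} (hK₁ : 2 ≤ K₁)
    (hM : ∀ j, K₁ ≤ j → |∑ k ∈ Finset.Ico K₁ j, d k| ≤ M j) (hM0 : ∀ j, 0 ≤ M j) {K₂ : ℕ}
    (hK : K₁ ≤ K₂) :
    |∑ k ∈ Finset.Ico K₁ K₂, d k / k| ≤
      2 * M K₂ / K₂ + ∑ k ∈ Finset.Ico K₁ K₂, M (k + 1) / (k : ℝ) ^ 2 := by
  rw [abel_identity d hK₁ K₂ hK]
  have hK2 : (2 : ℝ) ≤ K₂ := by exact_mod_cast hK₁.trans hK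
  refine (abs_add_le _ _).trans (add_le_add ?_ ?_)
  · rw [abs_div, abs_of_pos (by linarith : (0 : ℝ) < K₂ - 1)]
    calc |∑ k ∈ Finset.Ico K₁ K₂, d k| / ((K₂ : ℝ) - 1) ≤ M K₂ / ((K₂ : ℝ) - 1) :=
          div_le_div_of_nonneg_right (hM K₂ hK) (by linarith)
      _ ≤ 2 * M K₂ / K₂ := by
          rw [div_le_div_iff₀ (by linarith) (by linarith)]
          nlinarith [mul_nonneg (hM0 K₂) (by linarith : (0 : ℝ) ≤ (K₂ : ℝ) - 2)]
  · refine (Finset.abs_sum_le_sum_abs _ _).trans ?_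
    calc ∑ j ∈ Finset.Ico (K₁ + 1) K₂, |(∑ k ∈ Finset.Ico K₁ j, d k) / ((j : ℝ) * ((j : ℝ) - 1))|
        ≤ ∑ j ∈ Finset.Ico (K₁ + 1) K₂, M j / ((j : ℝ) - 1) ^ 2 := by
          refine Finset.sum_le_sum fun j hj ↦ ?_
          have hj1' : K₁ + 1 ≤ j := (Finset.mem_Ico.1 hj).1
          have hj' : (K₁ : ℝ) + 1 ≤ j := by exact_mod_cast hj1'
          have hj1 : (0 : ℝ) < (j : ℝ) - 1 := by
            have : (2 : ℝ) ≤ K₁ := by exact_mod_cast hK₁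
            linarith
          have hj0 : (0 : ℝ) < j := by linarith
          rw [abs_div, abs_of_pos (mul_pos hj0 hj1)]
          calc |∑ k ∈ Finset.Ico K₁ j, d k| / ((j : ℝ) * ((j : ℝ) - 1))
              ≤ M j / ((j : ℝ) * ((j : ℝ) - 1)) :=
                div_le_div_of_nonneg_right (hM j (by omega)) (mul_pos hj0 hj1).le
            _ ≤ M j / ((j : ℝ) - 1) ^ 2 :=
                div_le_div_of_nonneg_left (hM0 j) (pow_pos hj1 2) (by nlinarith)
      _ ≤ ∑ j ∈ Finset.Ico (K₁ + 1) (K₂ + 1), M j / ((j : ℝ) - 1) ^ 2 :=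
          Finset.sum_le_sum_of_subset_of_nonneg (Finset.Ico_subset_Ico le_rfl (Nat.le_succ _))
            (fun j _ _ ↦ div_nonneg (hM0 j) (sq_nonneg _))
      _ = ∑ k ∈ Finset.Ico K₁ K₂, M (k + 1) / (k : ℝ) ^ 2 := by
          rw [← Finset.sum_Ico_add' (fun j ↦ M j / ((j : ℝ) - 1) ^ 2) K₁ K₂ 1]
          refine Finset.sum_congr rfl fun k _ ↦ ?_
          push_cast
          ring_nf

/-! ### Summable majorants and vanishing tails -/

/-- `Σ_k (a + b log(k + c))/k² < ∞` for `a, b ≥ 0`, `c ≥ 1`. [folklore] -/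
private theorem summable_log_div_sq {a b c : ℝ} (ha : 0 ≤ a) (hb : 0 ≤ b) (hc : 1 ≤ c) :
    Summable fun k : ℕ ↦ (a + b * Real.log (k + c)) / (k : ℝ) ^ 2 := by
  have hs1 : Summable fun k : ℕ ↦ 1 / (k : ℝ) ^ 2 := Real.summable_one_div_nat_pow.2 one_lt_two
  have hs2 : Summable fun k : ℕ ↦ 1 / (k : ℝ) ^ (3 / 2 : ℝ) :=
    Real.summable_one_div_nat_rpow.2 (by norm_num)
  refine Summable.of_nonneg_of_le (fun k ↦ ?_) (fun k ↦ ?_)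
    ((hs1.mul_left (a + b * Real.log (c + 1))).add (hs2.mul_left (2 * b)))
  · have : 0 ≤ Real.log (k + c) := Real.log_nonneg (by linarith [(k.cast_nonneg : (0 : ℝ) ≤ k)])
    exact div_nonneg (add_nonneg ha (mul_nonneg hb this)) (sq_nonneg _)
  · rcases Nat.eq_zero_or_pos k with rfl | hk
    · simp [Real.zero_rpow (by norm_num : (3 / 2 : ℝ) ≠ 0)]
    · have hk' : (0 : ℝ) < k := Nat.cast_pos.2 hk
      have hk1 : (1 : ℝ) ≤ k := by exact_mod_cast hk
      have hlog : Real.log (k + c) ≤ Real.log (c + 1) + Real.log k := by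
        rw [← Real.log_mul (by linarith) hk'.ne']
        exact Real.log_le_log (by linarith) (by nlinarith)
      have hlk : Real.log k ≤ 2 * (k : ℝ) ^ (1 / 2 : ℝ) := by
        have := Real.log_le_rpow_div hk'.le (by norm_num : (0 : ℝ) < 1 / 2)
        rw [div_eq_mul_inv, show ((1 : ℝ) / 2)⁻¹ = 2 by norm_num] at this
        linarith
      have hpow : (k : ℝ) ^ (1 / 2 : ℝ) / (k : ℝ) ^ 2 = 1 / (k : ℝ) ^ (3 / 2 : ℝ) := by
        rw [eq_div_iff (Real.rpow_pos_of_pos hk' _).ne', div_mul_eq_mul_div,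
          div_eq_iff (pow_pos hk' 2).ne', one_mul, ← Real.rpow_add hk',
          show (1 / 2 : ℝ) + 3 / 2 = 2 by norm_num, Real.rpow_two]
      calc (a + b * Real.log (k + c)) / (k : ℝ) ^ 2
          ≤ (a + b * (Real.log (c + 1) + 2 * (k : ℝ) ^ (1 / 2 : ℝ))) / (k : ℝ) ^ 2 := by
            gcongr
            exact hlog.trans (by linarith)
        _ = (a + b * Real.log (c + 1)) * (1 / (k : ℝ) ^ 2) +
              2 * b * ((k : ℝ) ^ (1 / 2 : ℝ) / (k : ℝ) ^ 2) := by ring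
        _ = (a + b * Real.log (c + 1)) * (1 / (k : ℝ) ^ 2) +
              2 * b * (1 / (k : ℝ) ^ (3 / 2 : ℝ)) := by rw [hpow]

/-- `(a + b log(K + c))/K → 0`. [folklore] -/
private theorem tendsto_log_div_nat (a b c : ℝ) :
    Tendsto (fun K : ℕ ↦ (a + b * Real.log (K + c)) / (K : ℝ)) atTop (𝓝 0) := by
  have h1 : Tendsto (fun K : ℕ ↦ a / (K : ℝ)) atTop (𝓝 0) := tendsto_const_div_atTop_nhds_zero_nat a
  have h2 : Tendsto (fun x : ℝ ↦ Real.log x ^ 1 / (1 * x + -c)) atTop (𝓝 0) :=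
    Real.tendsto_pow_log_div_mul_add_atTop 1 (-c) 1 one_ne_zero
  have h3 : Tendsto (fun K : ℕ ↦ (K : ℝ) + c) atTop atTop :=
    tendsto_atTop_add_const_right _ c tendsto_natCast_atTop_atTop
  have h4 : Tendsto (fun K : ℕ ↦ b * (Real.log ((K : ℝ) + c) / K)) atTop (𝓝 0) := by
    have := (h2.comp h3).const_mul b
    rw [mul_zero] at this
    refine this.congr fun K ↦ ?_
    simp only [Function.comp_apply, pow_one, one_mul, add_neg_cancel_right]
  have := h1.add h4
  rw [add_zero] at this
  refine this.congr fun K ↦ ?_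
  ring

/-- Finite tails are bounded by infinite tails (non-negative summable families). [folklore] -/
private theorem sum_Ico_le_tsum_shift {W : ℕ → ℝ} (hW : Summable W) (hW0 : ∀ k, 0 ≤ W k)
    (K₁ K₂ : ℕ) : ∑ k ∈ Finset.Ico K₁ K₂, W k ≤ ∑' j, W (j + K₁) := by
  rw [Finset.sum_Ico_eq_sum_range]
  have hs : Summable fun j ↦ W (j + K₁) := (summable_nat_add_iff K₁).2 hW
  calc ∑ k ∈ Finset.range (K₂ - K₁), W (K₁ + k) = ∑ j ∈ Finset.range (K₂ - K₁), W (j + K₁) :=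
        Finset.sum_congr rfl fun j _ ↦ by rw [add_comm]
    _ ≤ ∑' j, W (j + K₁) := hs.sum_le_tsum _ fun j _ ↦ hW0 _

/-! ### The Cauchy estimate along admissible heights -/

/-- **The Cauchy estimate along admissible heights.**  Let `t_k ∈ [k, k + 1]` with `±t_k` ordinates
of no zero, and let `C` be a unit-window constant for `χ`.  Then for `K₂ ≥ K₁ ≥ 2`,
`‖P(t_{K₂}) − P(t_{K₁})‖ ≤ Σ_{K₁ ≤ k < K₂} 4Cℒ_k(4n + 2ⁿ)/k² + n·(8B_q(K₂ + 1)/K₂ + Σ_{K₁ ≤ k < K₂} 4B_q(k + 2)/k²)`,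
`ℒ_k = log q + log(k + 6)`. [folklore] -/
private theorem norm_liPartialSum_sub_le_of_heights (hprim : χ.IsPrimitive) (hq : 1 < q) (n : ℕ)
    {C : ℝ} (hC0 : 0 ≤ C)
    (hC : ∀ (τ : ℝ) (P : Finset ℂ),
        (∀ ρ ∈ P, χ.LFunction ρ = 0 ∧ 0 < ρ.re ∧ ρ.re < 1 ∧ |ρ.im - τ| ≤ 1 / 2) →
        ∑ ρ ∈ P, (DirichletDisc.zeroOrder χ ρ : ℝ) ≤ C * (Real.log q + Real.log (|τ| + 4)))
    {t : ℕ → ℝ} (ht_lo : ∀ k : ℕ, (k : ℝ) ≤ t k) (ht_hi : ∀ k : ℕ, t k ≤ k + 1)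
    (ht_ne : ∀ k, ∀ ρ ∈ charNontrivialZeros χ, ρ.im ≠ t k ∧ ρ.im ≠ -t k)
    {K₁ K₂ : ℕ} (hK₁ : 2 ≤ K₁) (hK : K₁ ≤ K₂) :
    ‖(∑ᶠ ρ ∈ lfunctionZeroBox χ (t K₂), (DirichletDisc.zeroOrder χ ρ : ℂ) * (1 - (1 - 1 / ρ) ^ n)) -
      (∑ᶠ ρ ∈ lfunctionZeroBox χ (t K₁), (DirichletDisc.zeroOrder χ ρ : ℂ) * (1 - (1 - 1 / ρ) ^ n))‖ ≤
      ∑ k ∈ Finset.Ico K₁ K₂,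
          4 * C * (Real.log q + Real.log (k + 6)) * ((4 * n + 2 ^ n) / (k : ℝ) ^ 2) +
        n * (2 * (4 * (5 / 2 + Real.log (2 * ((q : ℝ) * ((K₂ : ℝ) + 1 + 4) * DirichletDisc.Zc)) / Real.log (7 / 6))) / K₂ +
          ∑ k ∈ Finset.Ico K₁ K₂,
            4 * (5 / 2 + Real.log (2 * ((q : ℝ) * (((k + 1 : ℕ) : ℝ) + 1 + 4) * DirichletDisc.Zc)) / Real.log (7 / 6)) / (k : ℝ) ^ 2) := by
  classical
  have hχ : χ ≠ 1 := ne_one_of_isPrimitive hprim hq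
  have ht_mono : Monotone t :=
    monotone_nat_of_le_succ fun k ↦ (ht_hi k).trans (by
      have := ht_lo (k + 1); push_cast at this; linarith)
  have hmemF : ∀ k ρ, ρ ∈ (shell_finite hχ (t k) (t (k + 1))).toFinset →
      ρ ∈ charNontrivialZeros χ ∧ t k < |ρ.im| ∧ |ρ.im| ≤ t (k + 1) :=
    fun k ρ h ↦ by rw [Set.Finite.mem_toFinset] at h; exact h
  have hsum := sum_Ico_shell_eq hχ ht_mono
    (fun ρ ↦ (DirichletDisc.zeroOrder χ ρ : ℂ) * (1 - (1 - 1 / ρ) ^ n)) K₁ K₂ hK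
  set d : ℕ → ℝ := fun k ↦ ∑ ρ ∈ (shell_finite hχ (t k) (t (k + 1))).toFinset,
    (DirichletDisc.zeroOrder χ ρ : ℝ) * Real.sign ρ.im with hd
  set E : ℕ → ℂ := fun k ↦ ∑ ρ ∈ (shell_finite hχ (t k) (t (k + 1))).toFinset,
    (DirichletDisc.zeroOrder χ ρ : ℂ) * ((1 - (1 - 1 / ρ) ^ n) + I * n * Real.sign ρ.im / k) with hE
  -- the block decomposition `Σ_{block k} m·term = E_k − i n d_k / k`
  have hblock : ∀ k : ℕ, ∑ ρ ∈ (shell_finite hχ (t k) (t (k + 1))).toFinset,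
      (DirichletDisc.zeroOrder χ ρ : ℂ) * (1 - (1 - 1 / ρ) ^ n) = E k - I * n * (d k : ℂ) / k := by
    intro k
    simp only [hE, hd]
    push_cast
    rw [mul_div_assoc, Finset.sum_div, Finset.mul_sum, ← Finset.sum_sub_distrib]
    refine Finset.sum_congr rfl fun ρ _ ↦ ?_
    ring
  -- the block error bound
  have hEle : ∀ k, 1 ≤ k →
      ‖E k‖ ≤ 4 * C * (Real.log q + Real.log (k + 6)) * ((4 * n + 2 ^ n) / (k : ℝ) ^ 2) := by
    intro k hk
    have hk2 : t (k + 1) ≤ (k : ℝ) + 2 := by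
      have := ht_hi (k + 1); push_cast at this; linarith
    simp only [hE]
    calc ‖∑ ρ ∈ (shell_finite hχ (t k) (t (k + 1))).toFinset, (DirichletDisc.zeroOrder χ ρ : ℂ) *
            ((1 - (1 - 1 / ρ) ^ n) + I * n * Real.sign ρ.im / k)‖
        ≤ ∑ ρ ∈ (shell_finite hχ (t k) (t (k + 1))).toFinset, (DirichletDisc.zeroOrder χ ρ : ℝ) *
            ‖(1 - (1 - 1 / ρ) ^ n) + I * n * Real.sign ρ.im / k‖ := by
          refine (norm_sum_le _ _).trans (le_of_eq (Finset.sum_congr rfl fun ρ _ ↦ ?_))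
          rw [norm_mul, Complex.norm_natCast]
      _ ≤ ∑ ρ ∈ (shell_finite hχ (t k) (t (k + 1))).toFinset,
            (DirichletDisc.zeroOrder χ ρ : ℝ) * ((4 * n + 2 ^ n) / (k : ℝ) ^ 2) := by
          refine Finset.sum_le_sum fun ρ hρ ↦ ?_
          obtain ⟨⟨-, h0, h1⟩, hlo, hhi⟩ := hmemF k ρ hρ
          exact mul_le_mul_of_nonneg_left (norm_term_add_le hk h0 h1
            (lt_of_le_of_lt (ht_lo k) hlo) (hhi.trans hk2) n) (Nat.cast_nonneg _)
      _ = (∑ ρ ∈ (shell_finite hχ (t k) (t (k + 1))).toFinset,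
            (DirichletDisc.zeroOrder χ ρ : ℝ)) * ((4 * n + 2 ^ n) / (k : ℝ) ^ 2) := by
          rw [Finset.sum_mul]
      _ ≤ 4 * C * (Real.log q + Real.log (k + 6)) * ((4 * n + 2 ^ n) / (k : ℝ) ^ 2) := by
          refine mul_le_mul_of_nonneg_right (sum_zeroOrder_le_of_abs_im_mem hC0 hC k _
            fun ρ hρ ↦ ?_) (by positivity)
          obtain ⟨hz, hlo, hhi⟩ := hmemF k ρ hρ
          exact ⟨hz, (ht_lo k).trans hlo.le, hhi.trans hk2⟩
  -- the signed partial sums are bounded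
  have hD : ∀ j : ℕ, K₁ ≤ j → |∑ k ∈ Finset.Ico K₁ j, d k| ≤
      4 * (5 / 2 + Real.log (2 * ((q : ℝ) * ((j : ℝ) + 1 + 4) * DirichletDisc.Zc)) / Real.log (7 / 6)) := by
    intro j hj
    simp only [hd]
    rw [sum_Ico_shell_eq hχ ht_mono (fun ρ ↦ (DirichletDisc.zeroOrder χ ρ : ℝ) * Real.sign ρ.im)
      K₁ j hj]
    have hK₁0 : 0 ≤ t K₁ := (Nat.cast_nonneg K₁).trans (ht_lo K₁)
    have hj0 : 0 ≤ t j := (Nat.cast_nonneg j).trans (ht_lo j)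
    have hBj := argSBound_mono (q := q) hj0 (ht_hi j)
    have hB0 := argSBound_nonneg (q := q) hj0
    rcases (ht_mono hj).eq_or_lt with heq | hlt
    · rw [Finset.sum_eq_zero, abs_zero]
      · linarith
      · intro ρ hρ
        obtain ⟨-, h1, h2⟩ := (Set.Finite.mem_toFinset _).1 hρ
        rw [heq] at h1
        exact absurd h1 (not_lt.2 h2)
    · rw [sum_shell_mul_sign_eq hχ hK₁0 (fun ρ hρ ↦ (ht_ne j ρ hρ).1)
        (fun ρ hρ ↦ (ht_ne j ρ hρ).2)]
      exact (abs_finsum_zeroOrder_sub_finsum_zeroOrder_neg_le hprim hq hK₁0 hlt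
        (fun ρ hρ ↦ (ht_ne K₁ ρ hρ).1) (fun ρ hρ ↦ (ht_ne K₁ ρ hρ).2)
        (fun ρ hρ ↦ (ht_ne j ρ hρ).1) (fun ρ hρ ↦ (ht_ne j ρ hρ).2)).trans (by linarith)
  have hAbel := abel_bound d
    (fun j : ℕ ↦ 4 * (5 / 2 + Real.log (2 * ((q : ℝ) * ((j : ℝ) + 1 + 4) * DirichletDisc.Zc)) / Real.log (7 / 6))) hK₁ hD
    (fun j ↦ mul_nonneg (by norm_num) (argSBound_nonneg (by positivity))) hK
  -- assemble
  rw [liPartialSum_sub hχ n (ht_mono hK), ← hsum, Finset.sum_congr rfl fun k _ ↦ hblock k,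
    Finset.sum_sub_distrib]
  have hI : ∑ k ∈ Finset.Ico K₁ K₂, I * n * (d k : ℂ) / k =
      I * n * ((∑ k ∈ Finset.Ico K₁ K₂, d k / k : ℝ) : ℂ) := by
    push_cast
    rw [Finset.mul_sum]
    refine Finset.sum_congr rfl fun k _ ↦ ?_
    ring
  rw [hI]
  calc ‖∑ k ∈ Finset.Ico K₁ K₂, E k - I * n * ((∑ k ∈ Finset.Ico K₁ K₂, d k / k : ℝ) : ℂ)‖
      ≤ ‖∑ k ∈ Finset.Ico K₁ K₂, E k‖ + ‖I * n * ((∑ k ∈ Finset.Ico K₁ K₂, d k / k : ℝ) : ℂ)‖ :=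
        norm_sub_le _ _
    _ ≤ ∑ k ∈ Finset.Ico K₁ K₂, ‖E k‖ + n * |∑ k ∈ Finset.Ico K₁ K₂, d k / k| := by
        refine add_le_add (norm_sum_le _ _) (le_of_eq ?_)
        rw [norm_mul, norm_mul, Complex.norm_I, one_mul, Complex.norm_natCast, Complex.norm_real,
          Real.norm_eq_abs]
    _ ≤ _ := by
        refine add_le_add (Finset.sum_le_sum fun k hk ↦ hEle k ?_)
          (mul_le_mul_of_nonneg_left hAbel (Nat.cast_nonneg n))
        have := (Finset.mem_Ico.1 hk).1
        omega

/-- **The window estimate inside one unit cell.**  For `K ≥ 1` and `K ≤ a ≤ b ≤ K + 1`: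
`‖P(b) − P(a)‖ ≤ 4Cℒ_K(n + 2ⁿ)/K`. [folklore] -/
private theorem norm_liPartialSum_sub_le_of_mem_cell (hprim : χ.IsPrimitive) (hq : 1 < q) (n : ℕ)
    {C : ℝ} (hC0 : 0 ≤ C)
    (hC : ∀ (τ : ℝ) (P : Finset ℂ),
        (∀ ρ ∈ P, χ.LFunction ρ = 0 ∧ 0 < ρ.re ∧ ρ.re < 1 ∧ |ρ.im - τ| ≤ 1 / 2) →
        ∑ ρ ∈ P, (DirichletDisc.zeroOrder χ ρ : ℝ) ≤ C * (Real.log q + Real.log (|τ| + 4)))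
    {K : ℕ} (hK : 1 ≤ K) {a b : ℝ} (ha : (K : ℝ) ≤ a) (hab : a ≤ b) (hb : b ≤ K + 1) :
    ‖(∑ᶠ ρ ∈ lfunctionZeroBox χ b, (DirichletDisc.zeroOrder χ ρ : ℂ) * (1 - (1 - 1 / ρ) ^ n)) -
      (∑ᶠ ρ ∈ lfunctionZeroBox χ a, (DirichletDisc.zeroOrder χ ρ : ℂ) * (1 - (1 - 1 / ρ) ^ n))‖ ≤
      4 * C * (Real.log q + Real.log (K + 6)) * ((n + 2 ^ n) / (K : ℝ)) := by
  have hχ : χ ≠ 1 := ne_one_of_isPrimitive hprim hq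
  refine (norm_liPartialSum_sub_le hχ n hab).trans ?_
  have hmem : ∀ ρ, ρ ∈ (shell_finite hχ a b).toFinset →
      ρ ∈ charNontrivialZeros χ ∧ a < |ρ.im| ∧ |ρ.im| ≤ b :=
    fun ρ h ↦ by rw [Set.Finite.mem_toFinset] at h; exact h
  calc ∑ ρ ∈ (shell_finite hχ a b).toFinset,
        (DirichletDisc.zeroOrder χ ρ : ℝ) * ‖1 - (1 - 1 / ρ) ^ n‖
      ≤ ∑ ρ ∈ (shell_finite hχ a b).toFinset,
          (DirichletDisc.zeroOrder χ ρ : ℝ) * ((n + 2 ^ n) / (K : ℝ)) := by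
        refine Finset.sum_le_sum fun ρ hρ ↦ ?_
        obtain ⟨⟨-, h0, -⟩, hlo, -⟩ := hmem ρ hρ
        exact mul_le_mul_of_nonneg_left (norm_term_le hK h0 (ha.trans hlo.le) n) (Nat.cast_nonneg _)
    _ = (∑ ρ ∈ (shell_finite hχ a b).toFinset, (DirichletDisc.zeroOrder χ ρ : ℝ)) *
          ((n + 2 ^ n) / (K : ℝ)) := by rw [Finset.sum_mul]
    _ ≤ 4 * C * (Real.log q + Real.log (K + 6)) * ((n + 2 ^ n) / (K : ℝ)) := by
        refine mul_le_mul_of_nonneg_right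
          (sum_zeroOrder_le_of_abs_im_mem hC0 hC K _ fun ρ hρ ↦ ?_) (by positivity)
        obtain ⟨hz, hlo, hhi⟩ := hmem ρ hρ
        exact ⟨hz, ha.trans hlo.le, hhi.trans (hb.trans (by linarith))⟩

/-! ### Existence of the symmetric limit -/

/-- **Li's partial sums converge** (the existence statement behind Li 2004, Theorem 4): for a
primitive `χ` mod `q > 1` and every `n`, `Σ_{|Im ρ| ≤ T} m_χ(ρ)[1 − (1 − 1/ρ)ⁿ]` has a limit as
`T → ∞`. [cite: Li2004, Theorem 4] -/
theorem exists_tendsto_liPartialSum (hprim : χ.IsPrimitive) (hq : 1 < q) (n : ℕ) :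
    ∃ L : ℂ, Tendsto (fun T : ℝ ↦ ∑ᶠ ρ ∈ lfunctionZeroBox χ T,
      (DirichletDisc.zeroOrder χ ρ : ℂ) * (1 - (1 - 1 / ρ) ^ n)) atTop (𝓝 L) := by
  classical
  have hlogq : 0 < Real.log q := Real.log_pos (by exact_mod_cast hq)
  have h76 : 0 < Real.log (7 / 6) := Real.log_pos (by norm_num)
  have hA0 := argSConst_nonneg (q := q)
  -- the unit-window constant
  obtain ⟨C, hC0, hCall⟩ := exists_sum_window_le
  have hC : ∀ (τ : ℝ) (P : Finset ℂ),
      (∀ ρ ∈ P, χ.LFunction ρ = 0 ∧ 0 < ρ.re ∧ ρ.re < 1 ∧ |ρ.im - τ| ≤ 1 / 2) →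
      ∑ ρ ∈ P, (DirichletDisc.zeroOrder χ ρ : ℝ) ≤ C * (Real.log q + Real.log (|τ| + 4)) :=
    fun τ P hP ↦ hCall q χ hprim hq τ P hP
  -- admissible heights `t k ∈ [k, k + 1]`, `±t k` ordinates of no zero
  obtain ⟨c₀, hc0, hgood⟩ := exists_goodHeight
  have hH : ∀ k : ℕ, ∃ T : ℝ, ((k : ℝ) ≤ T ∧ T ≤ k + 1) ∧
      ∀ ρ ∈ charNontrivialZeros χ, ρ.im ≠ T ∧ ρ.im ≠ -T := by
    intro k
    obtain ⟨T, ⟨hT1, hT2⟩, hT⟩ := hgood q χ hprim hq k (Nat.cast_nonneg k)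
    refine ⟨T, ⟨hT1, hT2⟩, fun ρ hρ ↦ ?_⟩
    have hpos : 0 < c₀ / (Real.log q + Real.log (|T| + 4)) :=
      div_pos hc0 (add_pos hlogq (Real.log_pos (by linarith [abs_nonneg T])))
    have hd := hpos.trans_le (hT ρ hρ.1 hρ.2.1 hρ.2.2)
    have hne : |ρ.im| ≠ T := fun h ↦ by rw [h, sub_self, abs_zero] at hd; exact lt_irrefl _ hd
    have hT0 : 0 ≤ T := (Nat.cast_nonneg k).trans hT1
    exact ⟨fun h ↦ hne (by rw [h, abs_of_nonneg hT0]),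
      fun h ↦ hne (by rw [h, abs_neg, abs_of_nonneg hT0])⟩
  choose t ht htne using hH
  have ht_lo : ∀ k : ℕ, (k : ℝ) ≤ t k := fun k ↦ (ht k).1
  have ht_hi : ∀ k : ℕ, t k ≤ k + 1 := fun k ↦ (ht k).2
  -- the majorants
  set W₁ : ℕ → ℝ := fun k ↦
    4 * C * (Real.log q + Real.log (k + 6)) * ((4 * n + 2 ^ n) / (k : ℝ) ^ 2) with hW₁
  set W₂ : ℕ → ℝ := fun k ↦
    4 * (5 / 2 + Real.log (2 * ((q : ℝ) * (((k + 1 : ℕ) : ℝ) + 1 + 4) * DirichletDisc.Zc)) / Real.log (7 / 6)) / (k : ℝ) ^ 2 with hW₂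
  set β : ℕ → ℝ := fun K ↦
    2 * (4 * (5 / 2 + Real.log (2 * ((q : ℝ) * ((K : ℝ) + 1 + 4) * DirichletDisc.Zc)) / Real.log (7 / 6))) / K with hβ
  have hW₁s : Summable W₁ := by
    have := summable_log_div_sq (a := 4 * C * (4 * n + 2 ^ n) * Real.log q)
      (b := 4 * C * (4 * n + 2 ^ n)) (c := 6) (by positivity) (by positivity) (by norm_num)
    refine this.congr fun k ↦ ?_
    simp only [hW₁]; ring
  have hW₂s : Summable W₂ := by
    have := summable_log_div_sq
      (a := 4 * (5 / 2 + Real.log (2 * (q : ℝ) * DirichletDisc.Zc) / Real.log (7 / 6)))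
      (b := 4 * (1 / Real.log (7 / 6))) (c := 6) (mul_nonneg (by norm_num) hA0) (by positivity)
      (by norm_num)
    refine this.congr fun k ↦ ?_
    simp only [hW₂]
    rw [argSBound_eq (by positivity)]
    push_cast
    ring_nf
  have hW₁0 : ∀ k, 0 ≤ W₁ k := fun k ↦ by
    have h1 : 0 ≤ Real.log ((k : ℝ) + 6) := Real.log_nonneg (by linarith [(k.cast_nonneg : (0 : ℝ) ≤ k)])
    simp only [hW₁]
    exact mul_nonneg (mul_nonneg (by positivity) (add_nonneg hlogq.le h1)) (by positivity)
  have hW₂0 : ∀ k, 0 ≤ W₂ k := fun k ↦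
    div_nonneg (mul_nonneg (by norm_num) (argSBound_nonneg (by positivity))) (sq_nonneg _)
  have hβ0 : Tendsto β atTop (𝓝 0) := by
    have := tendsto_log_div_nat
      (8 * (5 / 2 + Real.log (2 * (q : ℝ) * DirichletDisc.Zc) / Real.log (7 / 6)))
      (8 * (1 / Real.log (7 / 6))) 5
    refine this.congr fun K ↦ ?_
    simp only [hβ]
    rw [argSBound_eq (by positivity)]
    ring_nf
  -- the sequence along the heights is Cauchy
  set u : ℕ → ℂ := fun K ↦ ∑ᶠ ρ ∈ lfunctionZeroBox χ (t K),
    (DirichletDisc.zeroOrder χ ρ : ℂ) * (1 - (1 - 1 / ρ) ^ n) with hu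
  have hmain : ∀ K₁ K₂, 2 ≤ K₁ → K₁ ≤ K₂ →
      ‖u K₂ - u K₁‖ ≤ (∑' j, W₁ (j + K₁)) + n * (β K₂ + ∑' j, W₂ (j + K₁)) := by
    intro K₁ K₂ hK₁ hK
    have h := norm_liPartialSum_sub_le_of_heights hprim hq n hC0.le hC ht_lo ht_hi htne hK₁ hK
    have h1 := sum_Ico_le_tsum_shift hW₁s hW₁0 K₁ K₂
    have h2 := sum_Ico_le_tsum_shift hW₂s hW₂0 K₁ K₂
    have hn0 : (0 : ℝ) ≤ n := Nat.cast_nonneg n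
    calc ‖u K₂ - u K₁‖ ≤ _ := h
      _ = (∑ k ∈ Finset.Ico K₁ K₂, W₁ k) + n * (β K₂ + ∑ k ∈ Finset.Ico K₁ K₂, W₂ k) := rfl
      _ ≤ (∑' j, W₁ (j + K₁)) + n * (β K₂ + ∑' j, W₂ (j + K₁)) :=
          add_le_add h1 (mul_le_mul_of_nonneg_left (add_le_add le_rfl h2) hn0)
  have hcauchy : CauchySeq u := by
    refine Metric.cauchySeq_iff'.2 fun ε hε ↦ ?_
    have hT₁ := tendsto_sum_nat_add W₁
    have hT₂ := tendsto_sum_nat_add W₂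
    set δ : ℝ := ε / (3 * (n + 1)) with hδ
    have hδ0 : 0 < δ := by positivity
    obtain ⟨N₁, hN₁⟩ := Metric.tendsto_atTop.1 hT₁ δ hδ0
    obtain ⟨N₂, hN₂⟩ := Metric.tendsto_atTop.1 hT₂ δ hδ0
    obtain ⟨N₃, hN₃⟩ := Metric.tendsto_atTop.1 hβ0 δ hδ0
    refine ⟨max 2 (max N₁ (max N₂ N₃)), fun K hK ↦ ?_⟩
    set N := max 2 (max N₁ (max N₂ N₃)) with hN
    have hN2 : 2 ≤ N := le_max_left _ _
    have hNN₁ : N₁ ≤ N := (le_max_left _ _).trans (le_max_right _ _)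
    have hNN₂ : N₂ ≤ N := ((le_max_left _ _).trans (le_max_right _ _)).trans (le_max_right _ _)
    have hNN₃ : N₃ ≤ N := ((le_max_right _ _).trans (le_max_right _ _)).trans (le_max_right _ _)
    have e1 := hN₁ N hNN₁
    have e2 := hN₂ N hNN₂
    have e3 := hN₃ K (hNN₃.trans hK)
    rw [Real.dist_0_eq_abs, abs_lt] at e1 e2 e3
    rw [dist_eq_norm]
    have hn0 : (0 : ℝ) ≤ n := Nat.cast_nonneg n
    calc ‖u K - u N‖ ≤ (∑' j, W₁ (j + N)) + n * (β K + ∑' j, W₂ (j + N)) := hmain N K hN2 hK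
      _ < δ + n * (δ + δ) := by
          have : n * (β K + ∑' j, W₂ (j + N)) ≤ n * (δ + δ) :=
            mul_le_mul_of_nonneg_left (by linarith [e2.2, e3.2]) hn0
          linarith [e1.2]
      _ ≤ ε := by
          rw [hδ]
          have h3 : (0 : ℝ) < 3 * (n + 1) := by positivity
          rw [show ε / (3 * (n + 1)) + n * (ε / (3 * (n + 1)) + ε / (3 * (n + 1))) =
            ε * ((2 * n + 1) / (3 * (n + 1))) by field_simp; ring]
          have : (2 * n + 1) / (3 * ((n : ℝ) + 1)) ≤ 1 := by
            rw [div_le_one h3]; linarith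
          exact mul_le_of_le_one_right hε.le this
  obtain ⟨L, hL⟩ := cauchySeq_tendsto_of_complete hcauchy
  -- from the heights to every real `T`
  refine ⟨L, Metric.tendsto_atTop.2 fun ε hε ↦ ?_⟩
  obtain ⟨N₁, hN₁⟩ := Metric.tendsto_atTop.1 hL (ε / 2) (half_pos hε)
  have hg := tendsto_log_div_nat (4 * C * (n + 2 ^ n) * Real.log q) (4 * C * (n + 2 ^ n)) 6
  obtain ⟨N₂, hN₂⟩ := Metric.tendsto_atTop.1 hg (ε / 2) (half_pos hε)
  refine ⟨max ((N₁ : ℝ) + 1) ((N₂ : ℝ) + 1), fun T hT ↦ ?_⟩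
  have hT₁ : (N₁ : ℝ) + 1 ≤ T := (le_max_left _ _).trans hT
  have hT₂ : (N₂ : ℝ) + 1 ≤ T := (le_max_right _ _).trans hT
  have hT0 : 0 ≤ T := by linarith [(N₁.cast_nonneg : (0 : ℝ) ≤ N₁)]
  set K := ⌊T⌋₊ with hK
  have hKT : (K : ℝ) ≤ T := Nat.floor_le hT0
  have hTK : T < K + 1 := Nat.lt_floor_add_one T
  have hK₁ : N₁ ≤ K := by
    rw [hK, Nat.le_floor_iff hT0]; linarith
  have hK₂ : N₂ ≤ K := by
    rw [hK, Nat.le_floor_iff hT0]; linarith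
  have hK1 : 1 ≤ K := by
    rw [hK, Nat.le_floor_iff hT0]; push_cast; linarith [(N₁.cast_nonneg : (0 : ℝ) ≤ N₁)]
  have hcell : ‖(∑ᶠ ρ ∈ lfunctionZeroBox χ T, (DirichletDisc.zeroOrder χ ρ : ℂ) * (1 - (1 - 1 / ρ) ^ n)) - u K‖ ≤
      4 * C * (Real.log q + Real.log (K + 6)) * ((n + 2 ^ n) / (K : ℝ)) := by
    rcases le_total T (t K) with h | h
    · rw [norm_sub_rev]
      exact norm_liPartialSum_sub_le_of_mem_cell hprim hq n hC0.le hC hK1 hKT h (ht_hi K)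
    · exact norm_liPartialSum_sub_le_of_mem_cell hprim hq n hC0.le hC hK1 (ht_lo K) h hTK.le
  have e2 := hN₂ K hK₂
  rw [Real.dist_0_eq_abs, abs_lt] at e2
  have e1 := hN₁ K hK₁
  calc dist (∑ᶠ ρ ∈ lfunctionZeroBox χ T, (DirichletDisc.zeroOrder χ ρ : ℂ) * (1 - (1 - 1 / ρ) ^ n)) L
      ≤ dist (∑ᶠ ρ ∈ lfunctionZeroBox χ T, (DirichletDisc.zeroOrder χ ρ : ℂ) * (1 - (1 - 1 / ρ) ^ n)) (u K) + dist (u K) L :=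
        dist_triangle _ _ _
    _ < ε / 2 + ε / 2 := by
        refine add_lt_add_of_le_of_lt ?_ e1
        rw [dist_eq_norm]
        refine hcell.trans ?_
        have : 4 * C * (Real.log q + Real.log (K + 6)) * ((n + 2 ^ n) / (K : ℝ)) =
            (4 * C * (n + 2 ^ n) * Real.log q +
              4 * C * (n + 2 ^ n) * Real.log ((K : ℝ) + 6)) / K := by
          ring
        rw [this]
        exact e2.2.le
    _ = ε := by ring

/-- **Li 2004, Theorem 4 (existence of `λ_χ(n)` as printed).**  For a primitive Dirichlet character
`χ` modulo `q > 1` — complex characters included — and every `n`, Li's partial sums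
`Σ_{|Im ρ| ≤ T} m_χ(ρ)[1 − (1 − 1/ρ)ⁿ]` over the non-trivial zeros of `L(s, χ)` converge as
`T → ∞`, to `λ_χ(n) = liCoeffChar χ n` ("the sum on `ρ` runs over all zeros of `ξ(s, χ)` in the
order given by `|Im ρ| < T` for `T → ∞`", p. 494; the value is evaluated in Li's Theorem 4, whose
arithmetic formula is not restated here). [cite: Li2004, Theorem 4] -/
theorem tendsto_liPartialSum (hprim : χ.IsPrimitive) (hq : 1 < q) (n : ℕ) :
    Tendsto (fun T : ℝ ↦ ∑ᶠ ρ ∈ lfunctionZeroBox χ T,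
        (DirichletDisc.zeroOrder χ ρ : ℂ) * (1 - (1 - 1 / ρ) ^ n)) atTop (𝓝 (liCoeffChar χ n)) :=
  tendsto_nhds_limUnder (exists_tendsto_liPartialSum hprim hq n)

/-- **`Re λ_χ(n) = Σ_ρ m_χ(ρ) Re[1 − (1 − 1/ρ)ⁿ]`** for every primitive `χ` mod `q > 1`: the real
part of Li's coefficient as printed is the absolutely convergent real sum `liCoeffCharRe χ n` of
the criterion (`LiCriterionDirichlet.lean`). [cite: Li2004, Theorem 4] -/
theorem re_liCoeffChar (hprim : χ.IsPrimitive) (hq : 1 < q) (n : ℕ) :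
    (liCoeffChar χ n).re = liCoeffCharRe χ n :=
  (re_eq_liCoeffCharRe_of_tendsto hprim hq (tendsto_liPartialSum hprim hq n)).2

/-- **Li's criterion for `L(s, χ)` literally as printed, for EVERY primitive character** (Li 2004,
p. 494: for `χ` primitive mod `r > 1`, all zeros of `ξ(s, χ)` lie on `Re s = 1/2` iff
`Re λ_χ(n) ≥ 0` for `n = 1, 2, …`, with `λ_χ(n)` his symmetric limit — which exists by
`tendsto_liPartialSum`): `χ.RiemannHypothesis ↔ ∀ n ≥ 1, 0 ≤ Re (liCoeffChar χ n)`.  (The tree's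
`riemannHypothesis_iff_liCoeffChar_nonneg_of_real` is the real-character case, where `λ_χ(n)` is
real.)  RH-EQUIVALENT `∀ n` statement; nothing here asserts either side.
[cite: Li2004, p. 494 and Theorem 2; BombieriLagarias1999, Theorem 1] -/
theorem riemannHypothesis_iff_re_liCoeffChar_nonneg (hprim : χ.IsPrimitive) (hq : 1 < q) :
    χ.RiemannHypothesis ↔ ∀ n : ℕ, 1 ≤ n → 0 ≤ (liCoeffChar χ n).re := by
  rw [riemannHypothesis_iff_liCoeffCharRe_nonneg hprim hq]
  simp only [re_liCoeffChar hprim hq]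

/-! ### `λ_{χ̄}(n) = conj λ_χ(n)` -/

/-- The box of `χ̄ = χ⁻¹` is the conjugate of the box of `χ`, with the same multiplicities
(`L(s̄, χ̄) = conj L(s, χ)`, MV §10.1 / Cor. 10.8). [cite: MontgomeryVaughan2007, Corollary 10.8] -/
theorem conj_mem_lfunctionZeroBox_inv (hχ : χ ≠ 1) {T : ℝ} {ρ : ℂ}
    (hρ : ρ ∈ lfunctionZeroBox χ T) : conj ρ ∈ lfunctionZeroBox χ⁻¹ T := by
  obtain ⟨hz, h0, h1, hT⟩ := hρ
  have hχ' : χ⁻¹ ≠ 1 := fun h ↦ hχ (inv_eq_one.1 h)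
  refine ⟨?_, by simpa using h0, by simpa using h1, by simpa using hT⟩
  have hm : 0 < DirichletDisc.zeroOrder χ⁻¹ (conj ρ) := by
    rw [WeilConverseChar.zeroOrder_inv_conj hχ ρ]
    exact (DirichletDisc.zeroOrder_pos_iff χ hχ ρ).2 hz
  exact (DirichletDisc.zeroOrder_pos_iff χ⁻¹ hχ' _).1 hm

/-- **`conj Σ_{|Im ρ| ≤ T} m_χ(ρ)[1 − (1 − 1/ρ)ⁿ] = Σ_{|Im ρ| ≤ T} m_{χ̄}(ρ)[1 − (1 − 1/ρ)ⁿ]`**: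
conjugation maps the box of `χ` onto the box of `χ̄` preserving multiplicities.
[cite: MontgomeryVaughan2007, Corollary 10.8] -/
theorem conj_liPartialSum (hχ : χ ≠ 1) (n : ℕ) (T : ℝ) :
    conj (∑ᶠ ρ ∈ lfunctionZeroBox χ T, (DirichletDisc.zeroOrder χ ρ : ℂ) * (1 - (1 - 1 / ρ) ^ n)) =
      ∑ᶠ ρ ∈ lfunctionZeroBox χ⁻¹ T, (DirichletDisc.zeroOrder χ⁻¹ ρ : ℂ) * (1 - (1 - 1 / ρ) ^ n) := by
  classical
  have hχ' : χ⁻¹ ≠ 1 := fun h ↦ hχ (inv_eq_one.1 h)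
  rw [finsum_mem_eq_finite_toFinset_sum _ (lfunctionZeroBox_finite hχ T),
    finsum_mem_eq_finite_toFinset_sum _ (lfunctionZeroBox_finite hχ' T), map_sum]
  have hterm : ∀ ρ : ℂ, conj ((DirichletDisc.zeroOrder χ ρ : ℂ) * (1 - (1 - 1 / ρ) ^ n)) =
      (DirichletDisc.zeroOrder χ⁻¹ (conj ρ) : ℂ) * (1 - (1 - 1 / conj ρ) ^ n) := by
    intro ρ
    rw [WeilConverseChar.zeroOrder_inv_conj hχ ρ, map_mul, map_natCast, map_sub, map_one, map_pow,
      map_sub, map_one, map_div₀, map_one]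
  simp_rw [hterm]
  set B := (lfunctionZeroBox_finite hχ T).toFinset with hB
  set B' := (lfunctionZeroBox_finite hχ' T).toFinset with hB'
  have hmem : ∀ ρ, ρ ∈ B ↔ ρ ∈ lfunctionZeroBox χ T := fun ρ ↦ Set.Finite.mem_toFinset _
  have hmem' : ∀ ρ, ρ ∈ B' ↔ ρ ∈ lfunctionZeroBox χ⁻¹ T := fun ρ ↦ Set.Finite.mem_toFinset _
  have hback : ∀ ρ, ρ ∈ lfunctionZeroBox χ⁻¹ T → conj ρ ∈ lfunctionZeroBox χ T := by
    intro ρ hρ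
    have := conj_mem_lfunctionZeroBox_inv hχ' hρ
    rwa [inv_inv] at this
  exact Finset.sum_nbij' (fun ρ ↦ conj ρ) (fun ρ ↦ conj ρ)
    (fun ρ hρ ↦ (hmem' _).2 (conj_mem_lfunctionZeroBox_inv hχ ((hmem ρ).1 hρ)))
    (fun ρ hρ ↦ (hmem _).2 (hback ρ ((hmem' ρ).1 hρ)))
    (fun ρ _ ↦ Complex.conj_conj ρ) (fun ρ _ ↦ Complex.conj_conj ρ) fun ρ _ ↦ rfl

/-- **`λ_{χ̄}(n) = conj λ_χ(n)`** for a primitive `χ` mod `q > 1` (Li's Theorem 4 carries `χ̄(k)`: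
the coefficient of the conjugate character is the conjugate; for a real character `λ_χ(n)` is
real, `liCoeffChar_of_real`). [cite: Li2004, Theorem 4] -/
theorem liCoeffChar_inv (hprim : χ.IsPrimitive) (hq : 1 < q) (n : ℕ) :
    liCoeffChar χ⁻¹ n = conj (liCoeffChar χ n) := by
  have hχ : χ ≠ 1 := ne_one_of_isPrimitive hprim hq
  have h := (Complex.continuous_conj.tendsto _).comp (tendsto_liPartialSum hprim hq n)
  have h' : Tendsto (fun T : ℝ ↦ ∑ᶠ ρ ∈ lfunctionZeroBox χ⁻¹ T,
      (DirichletDisc.zeroOrder χ⁻¹ ρ : ℂ) * (1 - (1 - 1 / ρ) ^ n)) atTop (𝓝 (conj (liCoeffChar χ n))) := by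
    refine h.congr fun T ↦ ?_
    exact conj_liPartialSum hχ n T
  exact h'.limUnder_eq

/-- **The imaginary part of `λ_χ(n)` as a symmetric limit**: `Im λ_χ(n) = lim_{T → ∞}
Σ_{|Im ρ| ≤ T} m_χ(ρ) Im[1 − (1 − 1/ρ)ⁿ]` (the limit exists; it changes sign under `χ ↦ χ̄`,
`liCoeffChar_inv`). [cite: Li2004, Theorem 4] -/
theorem tendsto_im_liPartialSum (hprim : χ.IsPrimitive) (hq : 1 < q) (n : ℕ) :
    Tendsto (fun T : ℝ ↦ (∑ᶠ ρ ∈ lfunctionZeroBox χ T,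
        (DirichletDisc.zeroOrder χ ρ : ℂ) * (1 - (1 - 1 / ρ) ^ n)).im)
      atTop (𝓝 (liCoeffChar χ n).im) :=
  (Complex.continuous_im.tendsto _).comp (tendsto_liPartialSum hprim hq n)

end LiDirichlet

end Literature.NumberTheory.LFunctions

end
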